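import Mathlib

/-!
# Certified hcp lattice sums: definitions and the form `Q` — stub `stub_pinNumerics` of line `vanishing-excess-truss-rigidity` (crux `CoarseGrains`, stmt-AtomisticToContinuum-9331)

The window pin of the line needs certified two-sided bounds on the hcp lattice sums
`S e c = ∑_{v ≠ 0} (Q v + k²c²)⁻ᵉ` (`v = (k,i,j) ∈ ℤ³`, `Q(k,i,j) = i² + ij + j² + [k odd](i+j+1/3)`
the squared in-layer norm of the site, `c = h/a` the layer ratio; `S 3 = σ₆`, `S 6 = σ₁₂` of
`hcp(1, c)`; KiharaKoba1952 / Stillinger2001 for the classical values `14.454…`, `12.132…` at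
`c = √(2/3)`).  This file fixes the DEFINITIONS used by the certificate (they are literally the
`let`-bound `Q`, `S` of the registered stub, so the final theorem is stated about them by `rfl`) and
proves the elementary facts about the form `Q` and the general term: nonnegativity, the shell lower
bound `Q + k²c² ≥ (3/5) m²` when `max(|k|,|i|,|j|) ≥ m ≥ 4` and `c² ≥ 3/5`, positivity off the
origin, antitonicity in `c`.  It also defines the kernel-evaluable integer floor sum
`hcpSumFloorSum p q K e M = ∑_{v ∈ [-K,K]³∖0} ⌊M / N_v^e⌋`, `N_v = 3q²·Q(v) + 3p²k²` (so that
`Q + k²c² = N_v/(3q²)` at `c = p/q`), written with structural recursion so that `decide +kernel`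
evaluates it with GMP arithmetic (≈ 10 s for `37³` terms).  Soundness of the evaluator, the tail
bound and the certificate itself are in the sibling files `…PinTail`, `…PinEval`, `…PinKernelA/B`,
`…PinGridA/B`, `…PinNumerics`.  All statements are [folklore] numerics bookkeeping.
-/

noncomputable section

namespace Summit.AtomisticToContinuum.Crystallization.Theorems.ExcessDecayLiouvilleCoarseGrains

open Finset

/-! ## Definitions -/

/-- The hcp norm form `Q(k,i,j) = i² + ij + j² + [k odd](i + j + 1/3)`: for the hcp two-lattice with
unit in-layer spacing and layer spacing `c`, the site `(k,i,j)` has squared norm `Q + k²c²`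
(this is literally the `let Q` of `stub_pinNumerics`). [folklore] -/
def hcpSumQ (v : ℤ × ℤ × ℤ) : ℝ :=
  (v.2.1 : ℝ) ^ 2 + (v.2.1 : ℝ) * v.2.2 + (v.2.2 : ℝ) ^ 2 +
    (if Even v.1 then 0 else ((v.2.1 : ℝ) + v.2.2 + 1 / 3))

/-- The general term `[v ≠ 0] (Q v + k²c²)⁻ᵉ` of the lattice sum `S e c`. [folklore] -/
def hcpSumTerm (e : ℕ) (c : ℝ) (v : ℤ × ℤ × ℤ) : ℝ :=
  if v = 0 then 0 else ((hcpSumQ v + (v.1 : ℝ) ^ 2 * c ^ 2)⁻¹) ^ e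

/-- The lattice sum `S e c = ∑_{v ≠ 0} (Q v + k²c²)⁻ᵉ` (`S 3 = σ₆`, `S 6 = σ₁₂` of `hcp(1,c)`);
literally the `let S` of `stub_pinNumerics`. [folklore] -/
def hcpSumS (e : ℕ) (c : ℝ) : ℝ := ∑' v, hcpSumTerm e c v

/-- The index cube `[-K, K]³ ⊆ ℤ³`. [folklore] -/
def hcpSumCube (K : ℕ) : Finset (ℤ × ℤ × ℤ) :=
  Icc (-(K : ℤ)) K ×ˢ (Icc (-(K : ℤ)) K ×ˢ Icc (-(K : ℤ)) K)

/-- Explicit tail bound `T(e,K) = 25 (5/3)ᵉ (K+1)^{6-2e} / (3 K (K-1) (K-2))` for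
`∑_{v ∉ [-K,K]³} (Q v + k²c²)⁻ᵉ` when `c² ≥ 3/5`, `e ≥ 3`, `K ≥ 4` (cube shells: a shell of
sup-norm `m` has `24m² + 2` sites, each with `Q + k²c² ≥ (3/5) m²`). [folklore] -/
def hcpSumTail (e K : ℕ) : ℝ :=
  25 * (5 / 3 : ℝ) ^ e / ((K : ℝ) + 1) ^ (2 * e - 6) * (1 / 3) / ((K : ℝ) * (K - 1) * (K - 2))

/-- Integer numerator `3q²·Q(k,i,j) + 3p²k²` of `Q + k²c²` at `c = p/q`. [folklore] -/
def hcpSumNumZ (p q : ℕ) (k i j : ℤ) : ℤ :=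
  (q : ℤ) ^ 2 * (3 * (i * i + i * j + j * j) + (if Even k then 0 else 3 * i + 3 * j + 1)) +
    3 * (p : ℤ) ^ 2 * (k * k)

/-- Floor term `⌊M / N^e⌋` (`0` at the origin), indices shifted by `K`. [folklore] -/
def hcpSumFloorTerm (p q K e M kk ii jj : ℕ) : ℕ :=
  if kk = K ∧ ii = K ∧ jj = K then 0
  else M / (hcpSumNumZ p q ((kk : ℤ) - K) ((ii : ℤ) - K) ((jj : ℤ) - K)).toNat ^ e

/-- Inner loop `∑_{jj < n}` of the floor sum (structural recursion, kernel-evaluable). [folklore] -/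
def hcpSumLoopJ (p q K e M kk ii : ℕ) : ℕ → ℕ
  | 0 => 0
  | n + 1 => hcpSumLoopJ p q K e M kk ii n + hcpSumFloorTerm p q K e M kk ii n

/-- Middle loop `∑_{ii < n} ∑_{jj ≤ 2K}`. [folklore] -/
def hcpSumLoopI (p q K e M kk : ℕ) : ℕ → ℕ
  | 0 => 0
  | n + 1 => hcpSumLoopI p q K e M kk n + hcpSumLoopJ p q K e M kk n (2 * K + 1)

/-- Outer loop `∑_{kk < n} ∑_{ii ≤ 2K} ∑_{jj ≤ 2K}`. [folklore] -/
def hcpSumLoopK (p q K e M : ℕ) : ℕ → ℕ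
  | 0 => 0
  | n + 1 => hcpSumLoopK p q K e M n + hcpSumLoopI p q K e M n (2 * K + 1)

/-- The floor sum `∑_{v ∈ [-K,K]³ ∖ 0} ⌊M / N_v^e⌋`, a certified lower bound for
`M · ∑ N_v^{-e}` (and an upper bound up to the number of terms). [folklore] -/
def hcpSumFloorSum (p q K e M : ℕ) : ℕ := hcpSumLoopK p q K e M (2 * K + 1)

/-! ## The form `Q` and the terms -/

/-- `Q` on an even layer. [folklore] -/
theorem hcpSumQ_even {k i j : ℤ} (hk : Even k) : hcpSumQ (k, i, j) = (i : ℝ) ^ 2 + i * j + (j : ℝ) ^ 2 := by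
  simp [hcpSumQ, hk]

/-- `Q` on an odd layer. [folklore] -/
theorem hcpSumQ_odd {k i j : ℤ} (hk : ¬ Even k) :
    hcpSumQ (k, i, j) = (i : ℝ) ^ 2 + i * j + (j : ℝ) ^ 2 + ((i : ℝ) + j + 1 / 3) := by
  simp [hcpSumQ, hk]

/-- `Q ≥ (3/4)(i + s)²`, `s` the layer shift (`0` or `1/3`). [folklore] -/
theorem hcpSumQ_ge_sq_fst (k i j : ℤ) :
    3 / 4 * ((i : ℝ) + (if Even k then 0 else 1 / 3)) ^ 2 ≤ hcpSumQ (k, i, j) := by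
  by_cases hk : Even k
  · rw [hcpSumQ_even hk, if_pos hk]
    nlinarith [sq_nonneg ((i : ℝ) / 2 + j)]
  · rw [hcpSumQ_odd hk, if_neg hk]
    nlinarith [sq_nonneg (((i : ℝ) + 1 / 3) / 2 + (j + 1 / 3))]

/-- `Q ≥ (3/4)(j + s)²`. [folklore] -/
theorem hcpSumQ_ge_sq_snd (k i j : ℤ) :
    3 / 4 * ((j : ℝ) + (if Even k then 0 else 1 / 3)) ^ 2 ≤ hcpSumQ (k, i, j) := by
  by_cases hk : Even k
  · rw [hcpSumQ_even hk, if_pos hk]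
    nlinarith [sq_nonneg ((j : ℝ) / 2 + i)]
  · rw [hcpSumQ_odd hk, if_neg hk]
    nlinarith [sq_nonneg (((j : ℝ) + 1 / 3) / 2 + (i + 1 / 3))]

/-- `Q ≥ 0`. [folklore] -/
theorem hcpSumQ_nonneg (v : ℤ × ℤ × ℤ) : 0 ≤ hcpSumQ v := by
  obtain ⟨k, i, j⟩ := v
  have h := hcpSumQ_ge_sq_fst k i j
  nlinarith [sq_nonneg ((i : ℝ) + (if Even k then 0 else 1 / 3))]

/-- If `|i| ≥ m ≥ 1` then `Q ≥ (3/4)(m - 1/3)²`. [folklore] -/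
theorem hcpSumQ_ge_of_le_abs_fst {k i j : ℤ} {m : ℕ} (hm : 1 ≤ m) (hi : (m : ℤ) ≤ |i|) :
    3 / 4 * ((m : ℝ) - 1 / 3) ^ 2 ≤ hcpSumQ (k, i, j) := by
  refine le_trans ?_ (hcpSumQ_ge_sq_fst k i j)
  have hm1 : (1 : ℝ) ≤ m := by exact_mod_cast hm
  have hi' : (m : ℝ) ≤ |(i : ℝ)| := by
    rw [← Int.cast_abs]; exact_mod_cast hi
  have hs : (m : ℝ) - 1 / 3 ≤ |(i : ℝ) + (if Even k then 0 else 1 / 3)| := by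
    split_ifs
    · rw [add_zero]; linarith
    · have h2 : |(i : ℝ)| ≤ |(i : ℝ) + 1 / 3| + |(-(1 / 3) : ℝ)| := by
        have := abs_add_le ((i : ℝ) + 1 / 3) (-(1 / 3))
        simpa using this
      rw [abs_neg, abs_of_pos (by norm_num : (0 : ℝ) < 1 / 3)] at h2
      linarith
  have h0 : 0 ≤ (m : ℝ) - 1 / 3 := by linarith
  have := sq_le_sq' (by linarith [abs_nonneg ((i : ℝ) + (if Even k then 0 else 1 / 3))]) hs
  have hsq : ((m : ℝ) - 1 / 3) ^ 2 ≤ ((i : ℝ) + (if Even k then 0 else 1 / 3)) ^ 2 := by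
    calc ((m : ℝ) - 1 / 3) ^ 2 ≤ |(i : ℝ) + (if Even k then 0 else 1 / 3)| ^ 2 :=
          pow_le_pow_left₀ h0 hs 2
      _ = _ := sq_abs _
  linarith

/-- If `|j| ≥ m ≥ 1` then `Q ≥ (3/4)(m - 1/3)²`. [folklore] -/
theorem hcpSumQ_ge_of_le_abs_snd {k i j : ℤ} {m : ℕ} (hm : 1 ≤ m) (hj : (m : ℤ) ≤ |j|) :
    3 / 4 * ((m : ℝ) - 1 / 3) ^ 2 ≤ hcpSumQ (k, i, j) := by
  refine le_trans ?_ (hcpSumQ_ge_sq_snd k i j)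
  have hm1 : (1 : ℝ) ≤ m := by exact_mod_cast hm
  have hj' : (m : ℝ) ≤ |(j : ℝ)| := by
    rw [← Int.cast_abs]; exact_mod_cast hj
  have hs : (m : ℝ) - 1 / 3 ≤ |(j : ℝ) + (if Even k then 0 else 1 / 3)| := by
    split_ifs
    · rw [add_zero]; linarith
    · have h2 : |(j : ℝ)| ≤ |(j : ℝ) + 1 / 3| + |(-(1 / 3) : ℝ)| := by
        have := abs_add_le ((j : ℝ) + 1 / 3) (-(1 / 3))
        simpa using this
      rw [abs_neg, abs_of_pos (by norm_num : (0 : ℝ) < 1 / 3)] at h2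
      linarith
  have h0 : 0 ≤ (m : ℝ) - 1 / 3 := by linarith
  have hsq : ((m : ℝ) - 1 / 3) ^ 2 ≤ ((j : ℝ) + (if Even k then 0 else 1 / 3)) ^ 2 := by
    calc ((m : ℝ) - 1 / 3) ^ 2 ≤ |(j : ℝ) + (if Even k then 0 else 1 / 3)| ^ 2 :=
          pow_le_pow_left₀ h0 hs 2
      _ = _ := sq_abs _
  linarith

/-- **Shell bound for the squared norm**: if `max(|k|,|i|,|j|) ≥ m ≥ 4` and `c² ≥ 3/5` then
`Q + k²c² ≥ (3/5) m²`. [folklore] -/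
theorem hcpSum_r_ge {k i j : ℤ} {m : ℕ} (hm : 4 ≤ m)
    (hv : (m : ℤ) ≤ |k| ∨ (m : ℤ) ≤ |i| ∨ (m : ℤ) ≤ |j|) {c : ℝ} (hc : 3 / 5 ≤ c ^ 2) :
    3 / 5 * (m : ℝ) ^ 2 ≤ hcpSumQ (k, i, j) + (k : ℝ) ^ 2 * c ^ 2 := by
  have hm4 : (4 : ℝ) ≤ m := by exact_mod_cast hm
  have hQ := hcpSumQ_nonneg (k, i, j)
  have hk2 : 0 ≤ (k : ℝ) ^ 2 * c ^ 2 := by positivity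
  rcases hv with hk | hi | hj
  · have hk' : (m : ℝ) ≤ |(k : ℝ)| := by rw [← Int.cast_abs]; exact_mod_cast hk
    have hkk : (m : ℝ) ^ 2 ≤ (k : ℝ) ^ 2 := by
      calc (m : ℝ) ^ 2 ≤ |(k : ℝ)| ^ 2 := pow_le_pow_left₀ (by positivity) hk' 2
        _ = _ := sq_abs _
    nlinarith
  · have h := hcpSumQ_ge_of_le_abs_fst (k := k) (j := j) (by omega) hi
    nlinarith
  · have h := hcpSumQ_ge_of_le_abs_snd (k := k) (i := i) (by omega) hj
    nlinarith

/-- The integer form `i² + ij + j²` is `≥ 1` off the origin. [folklore] -/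
theorem hcpSum_one_le_form {i j : ℤ} (h : (i, j) ≠ (0, 0)) : (1 : ℝ) ≤ (i : ℝ) ^ 2 + i * j + (j : ℝ) ^ 2 := by
  have hz : 1 ≤ i ^ 2 + i * j + j ^ 2 := by
    by_cases hj : j = 0
    · subst hj
      have hi : i ≠ 0 := by rintro rfl; exact h rfl
      have : 0 < i ^ 2 := by positivity
      nlinarith
    · have h1 : 0 < j ^ 2 := by positivity
      nlinarith [sq_nonneg (2 * i + j)]
  exact_mod_cast hz

/-- **Positivity**: `Q v + k²c² > 0` for `v ≠ 0` and `c ≠ 0`. [folklore] -/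
theorem hcpSum_r_pos {v : ℤ × ℤ × ℤ} (hv : v ≠ 0) {c : ℝ} (hc : c ≠ 0) :
    0 < hcpSumQ v + (v.1 : ℝ) ^ 2 * c ^ 2 := by
  obtain ⟨k, i, j⟩ := v
  have hQ := hcpSumQ_nonneg (k, i, j)
  by_cases hk : k = 0
  · subst hk
    have hij : (i, j) ≠ (0, 0) := by
      rintro hij
      simp only [Prod.mk.injEq] at hij
      obtain ⟨rfl, rfl⟩ := hij
      exact hv rfl
    have h1 := hcpSum_one_le_form hij
    rw [hcpSumQ_even (show Even (0 : ℤ) from ⟨0, rfl⟩)]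
    simp only [Int.cast_zero]
    nlinarith
  · have : 0 < (k : ℝ) ^ 2 * c ^ 2 := by
      have hk' : (k : ℝ) ≠ 0 := by exact_mod_cast hk
      positivity
    dsimp only
    linarith

/-- The terms are nonnegative. [folklore] -/
theorem hcpSumTerm_nonneg : ∀ (e : ℕ) (c : ℝ) (v : ℤ × ℤ × ℤ), 0 ≤ hcpSumTerm e c v := by
  intro e c v
  unfold hcpSumTerm
  split_ifs
  · exact le_rfl
  · have := hcpSumQ_nonneg v
    positivity

/-- **Shell bound for the terms**: if `max(|k|,|i|,|j|) ≥ m ≥ 4`, `c² ≥ 3/5`, then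
`term ≤ ((3/5) m²)⁻ᵉ`. [folklore] -/
theorem hcpSumTerm_le_of_shell {e : ℕ} {c : ℝ} (hc : 3 / 5 ≤ c ^ 2) {m : ℕ} (hm : 4 ≤ m)
    {v : ℤ × ℤ × ℤ} (hv : (m : ℤ) ≤ |v.1| ∨ (m : ℤ) ≤ |v.2.1| ∨ (m : ℤ) ≤ |v.2.2|) :
    hcpSumTerm e c v ≤ ((3 / 5 * (m : ℝ) ^ 2)⁻¹) ^ e := by
  obtain ⟨k, i, j⟩ := v
  have hr := hcpSum_r_ge hm hv hc
  have hm0 : (0 : ℝ) < 3 / 5 * (m : ℝ) ^ 2 := by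
    have : (4 : ℝ) ≤ m := by exact_mod_cast hm
    positivity
  unfold hcpSumTerm
  split_ifs
  · positivity
  · have hQ := hcpSumQ_nonneg (k, i, j)
    have h0 : 0 ≤ (hcpSumQ (k, i, j) + ((k, i, j).1 : ℝ) ^ 2 * c ^ 2)⁻¹ := by
      rw [inv_nonneg]; positivity
    exact pow_le_pow_left₀ h0 (inv_anti₀ hm0 hr) e

/-- The terms are antitone in `c > 0`. [folklore] -/
theorem hcpSumTerm_antitone {e : ℕ} {c₁ c₂ : ℝ} (h₁ : 0 < c₁) (h₁₂ : c₁ ≤ c₂) (v : ℤ × ℤ × ℤ) :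
    hcpSumTerm e c₂ v ≤ hcpSumTerm e c₁ v := by
  unfold hcpSumTerm
  split_ifs with hv
  · exact le_rfl
  · have hr := hcpSum_r_pos hv h₁.ne'
    refine pow_le_pow_left₀ (by have := hcpSumQ_nonneg v; positivity) (inv_anti₀ hr ?_) e
    have : c₁ ^ 2 ≤ c₂ ^ 2 := pow_le_pow_left₀ h₁.le h₁₂ 2
    nlinarith [sq_nonneg (v.1 : ℝ)]


end Summit.AtomisticToContinuum.Crystallization.Theorems.ExcessDecayLiouvilleCoarseGrains

end
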